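import Summits.Langlands.Langlands.Theorems.PhantomRMYoshidaSerreKWAutomorphicGL2ConjugateNewform
import Literature.NumberTheory.EllipticCurves.NewformsSpanGamma1Proofs
import Literature.NumberTheory.EllipticCurves.DeligneSerreWeightOneProofs
import Mathlib.FieldTheory.IsAlgClosed.Basic
import HarnessLib

/-!
# Crux `AdjointLiftingGL3` (stmt-Langlands-16779), line `birth`, stub S2c — helper 1:
# Galois-conjugate newforms have the same level

Helper file of stub `stub_weightTwoNewform` (the aligned weight-two newform).  The alignment of
the coefficient map of the Khare–Wintenberger newform `f` with a fixed `ι : ℚ̄_p ≃ ℂ` replaces `f`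
by a Galois conjugate `f^τ`; the landed `stub_conjugateNewform` (crux `SerreKWAutomorphicGL2`)
produces the conjugate newform at SOME level `M`, which is not enough here (the exceptional set of
`WeightTwoNewformAlong` is `{q ∣ M p}` and must contain the primes of `N = N(σ̄)`).  We prove the
conjugate newform has level EXACTLY `N`:

* `level_eq_of_isNewform1_of_cuspCoeff_eq` — **multiplicity one across levels on `Γ₁(N)`**: a
  newform `g` of level `M ∣ N` with the `T_q`-eigenvalues (`q ∤ N`) and the character of a newform
  `f` of level `N` has `M = N` (else `ι₁ g - f` has `a₁ = 0`, is old by the Main Lemma, `ι₁ g` is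
  old, so `f` is old and new, `f = 0`; Diamond–Shurman Thm. 5.7.1, 5.8.2, Li 1975 Thm. 3);
* `level_eq_of_conj_packet` — if the `τ`-conjugate packet of a level-`N` newform `f` is the
  packet of a newform `g₀` of level `M₀ ∣ N`, then `M₀ = N`: conjugate BACK along an embedding
  `ψ : K_{g₀} → ℂ` inverting `τ` on the packet field (Mathlib `IsAlgClosed.lift` over the subfield
  `{x ∈ K_f | τ x ∈ K_{g₀}}`; `K_{g₀}` is a number field, Deligne–Serre (2.7.3)), land on a
  newform of level `M₃ ∣ M₀` with the packet of `f` (`exists_isNewform1_of_eigenpacket`), and apply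
  multiplicity one;
* `conjugateNewform_sameLevel` — the conjugate newform `g ∈ S_w(Γ₁(N))` with
  `H_q(g) = τ(H_q(f))` for all primes `q ∤ N` (Diamond–Shurman Thm. 6.5.4).

References: Diamond–Shurman, *A first course in modular forms*, Thm. 5.7.1, 5.8.2, 5.8.3, 6.5.4;
Deligne–Serre 1974, Prop. 2.7; Li 1975, Thm. 3.
-/

set_option linter.dupNamespace false -- `Summit.Langlands.Langlands` is the mandated namespace

noncomputable section

namespace Summit.Langlands.Langlands.Cruxes.AdjointLiftingGL3.Birth

open scoped Polynomial
open NumberField Polynomial CongruenceSubgroup Literature.NumberTheory.EllipticCurves.ModularForms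
open Summit.Langlands.Langlands.Cruxes.SerreKWAutomorphicGL2.AdelicNewformDatumDoubleTwist

/-! ## Multiplicity one across levels on `Γ₁(N)` -/

/-- **Multiplicity one across levels** (Atkin–Lehner–Li; Diamond–Shurman Thm. 5.7.1 and proof of
Thm. 5.8.2): a newform `g ∈ S_w(Γ₁(M))`, `M ∣ N`, whose Hecke eigenvalues `a_q(g)`, `q ∤ N`, and
character agree with those of a newform `f ∈ S_w(Γ₁(N))` has level `M = N`.  Proof: if `M < N`,
`h = ι₁ g ∈ S_w(Γ₁(N))^{old}` and `v = h - f` is a `T_q`-eigenvector (`q ∤ N`) and `⟨d⟩`-eigenvector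
with `a₁(v) = 0`, so `a_n(v) = 0` for `(n, N) = 1` (`cuspCoeff_eq_zero_of_coprime_gamma1`) and `v`
is old by the Main Lemma (`mem_oldSubspace1_of_coeff_eq_zero`); then `f = h - v` is old and new,
hence `0` (`disjoint_oldSubspace1_newSubspace1_holds`), contradicting `a₁(f) = 1`.
[cite: DiamondShurman2005, Thm. 5.7.1 and Thm. 5.8.2 (proof)] -/
theorem level_eq_of_isNewform1_of_cuspCoeff_eq {N : ℕ} [NeZero N] {w : ℤ}
    {f : CuspForm (Gamma1 N) w} (hf : IsNewform1 f) {M : ℕ} [NeZero M] (hM : M ∣ N)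
    {g : CuspForm (Gamma1 M) w} (hg : IsNewform1 g)
    (hcoeff : ∀ q : ℕ, q.Prime → ¬ q ∣ N → cuspCoeff g q = cuspCoeff f q)
    (hchar : DirichletCharacter.changeLevel hM (nebentypus g) = nebentypus f) : M = N := by
  classical
  by_contra hne
  have hMprop : M ∈ N.properDivisors :=
    Nat.mem_properDivisors.mpr ⟨hM, lt_of_le_of_ne (Nat.le_of_dvd (NeZero.pos N) hM) hne⟩
  have hM1 : M * 1 ∣ N := by rwa [mul_one]
  set h : CuspForm (Gamma1 N) w := degeneracyMap1 M N 1 w g with hh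
  -- `h` is old
  have hold : h ∈ oldSubspace1 N w :=
    range_degeneracyMap1_le_oldSubspace1 N w hMprop hM1 (LinearMap.mem_range_self _ _)
  -- eigenvalues of `g`, `f`
  have hTg : ∀ (q : ℕ) (hq : q.Prime),
      (haveI : NeZero q := ⟨hq.ne_zero⟩; heckeT (Gamma1 M) w q g) = cuspCoeff g q • g := by
    intro q hq
    haveI : NeZero q := ⟨hq.ne_zero⟩
    have h1 := heckeT_eq_heckeEigenvalue_smul g q (hg.2.1 q hq)
    rwa [IsNewform1.heckeEigenvalue_eq_coeff_holds hg hq] at h1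
  have hTf : ∀ (q : ℕ) (hq : q.Prime),
      (haveI : NeZero q := ⟨hq.ne_zero⟩; heckeT (Gamma1 N) w q f) = cuspCoeff f q • f := by
    intro q hq
    haveI : NeZero q := ⟨hq.ne_zero⟩
    have h1 := heckeT_eq_heckeEigenvalue_smul f q (hf.2.1 q hq)
    rwa [IsNewform1.heckeEigenvalue_eq_coeff_holds hf hq] at h1
  -- `T_q h = a_q(f) h` for `q ∤ N`
  have hTh : ∀ (q : ℕ) (hq : q.Prime), ¬ q ∣ N →
      (haveI : NeZero q := ⟨hq.ne_zero⟩; heckeT (Gamma1 N) w q h) = cuspCoeff f q • h := by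
    intro q hq hqN
    haveI : NeZero q := ⟨hq.ne_zero⟩
    have hqM : ¬ q ∣ M := fun h' => hqN (h'.trans hM)
    rw [hh, heckeT_degeneracyMap1_of_not_dvd w hM1 hq (Nat.Prime.not_dvd_one hq)
      ⟨fun h' => (hqM h').elim, fun h' => (hqN h').elim⟩, hTg q hq, map_smul, hcoeff q hq hqN]
  -- `⟨d⟩ h = ε_f(d) h`
  have hDh : ∀ d : (ZMod N)ˣ, diamondOp N w (d : ZMod N) h = nebentypus f (d : ZMod N) • h := by
    intro d
    rw [hh, diamondOp_degeneracyMap1 N w hM1 d.isUnit g]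
    obtain ⟨dM, hdM⟩ := d.isUnit.map (ZMod.castHom ((dvd_mul_right M 1).trans hM1) (ZMod M))
    rw [← hdM, hg.diamondOp_apply_eq_nebentypus_smul dM, map_smul, hdM, ← hchar,
      DirichletCharacter.changeLevel_eq_cast_of_dvd _ hM, ZMod.castHom_apply]
  have hDf : ∀ d : (ZMod N)ˣ, diamondOp N w (d : ZMod N) f = nebentypus f (d : ZMod N) • f :=
    hf.diamondOp_apply_eq_nebentypus_smul
  -- `v = h - f`
  set v : CuspForm (Gamma1 N) w := h - f with hv
  have hTv : ∀ (q : ℕ) (hq : q.Prime), ¬ q ∣ N →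
      (haveI : NeZero q := ⟨hq.ne_zero⟩; heckeT (Gamma1 N) w q v) = cuspCoeff f q • v := by
    intro q hq hqN
    haveI : NeZero q := ⟨hq.ne_zero⟩
    rw [hv, map_sub, hTh q hq hqN, hTf q hq, smul_sub]
  have hDv : ∀ d : (ZMod N)ˣ, ∃ c : ℂ, diamondOp N w (d : ZMod N) v = c • v := fun d =>
    ⟨nebentypus f (d : ZMod N), by rw [hv, map_sub, hDh d, hDf d, smul_sub]⟩
  have h1 : cuspCoeff v 1 = 0 := by
    have hg1 : cuspCoeff g 1 = 1 := hg.2.2.2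
    have hf1 : cuspCoeff f 1 = 1 := hf.2.2.2
    rw [hv, cuspCoeff_sub_gamma1, hh, cuspCoeff_degeneracyMap1 hM1, if_pos (one_dvd 1),
      Nat.div_one, hg1, hf1, Nat.cast_one, one_zpow, mul_one, sub_self]
  have hvold : v ∈ oldSubspace1 N w :=
    mem_oldSubspace1_of_coeff_eq_zero N w (atkinLehnerMainLemma1_holds N w) v
      (cuspCoeff_eq_zero_of_coprime_gamma1 v _ hTv hDv h1)
  have hfold : f ∈ oldSubspace1 N w := by
    have e : f = h - v := by rw [hv, sub_sub_cancel]
    rw [e]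
    exact sub_mem hold hvold
  exact hf.ne_zero
    ((Submodule.disjoint_def.mp (disjoint_oldSubspace1_newSubspace1_holds N w)) f hfold hf.1)


/-! ## The conjugate packet of a level-`N` newform is a level-`N` newform packet -/

set_option synthInstance.maxHeartbeats 200000 in
/-- **The `τ`-conjugate packet of a newform of level `N` is not the packet of a newform of lower
level.**  Let `f ∈ S_w(Γ₁(N))` be a newform, `τ : K_f → ℂ`, and `g₀ ∈ S_w(Γ₁(M₀))`, `M₀ ∣ N`, a
newform with `a_q(g₀) = τ(a_q(f))` for the primes `q ∤ N` and character `τ ∘ ε_f`.  Then `M₀ = N`.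
Proof: `K_{g₀}` is a number field (Deligne–Serre (2.7.3), `finiteDimensional_coeffField`), so the
inverse of `τ` on the subfield `R = {x ∈ K_f | τ x ∈ K_{g₀}}` (which contains the `a_q(f)`, `q ∤ N`,
and the `ε_f(u)`) extends to `ψ : K_{g₀} → ℂ` (Mathlib `IsAlgClosed.lift`); conjugating `g₀` along
`ψ` (`exists_conjEigenvector`, Deligne–Serre (2.7.4)) and passing to the newform of its packet
(`exists_isNewform1_of_eigenpacket`) gives a newform of level `M₃ ∣ M₀` with the packet of `f`,
so `M₃ = N` by multiplicity one across levels, whence `M₀ = N`.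
[cite: DiamondShurman2005, Thm. 6.5.4 and Thm. 5.8.2] [cite: DeligneSerreASENS1974, Prop. 2.7] -/
theorem level_eq_of_conj_packet {N : ℕ} [NeZero N] {w : ℤ} {f : CuspForm (Gamma1 N) w}
    (hf : IsNewform1 f) (τ : coeffCharField f →+* ℂ) {M₀ : ℕ} [NeZero M₀] (hM₀ : M₀ ∣ N)
    {g₀ : CuspForm (Gamma1 M₀) w} (hg₀ : IsNewform1 g₀)
    (hcoeff : ∀ (q : ℕ), q.Prime → ¬ q ∣ N →
      cuspCoeff g₀ q = τ ⟨cuspCoeff f q, cuspCoeff_mem_coeffCharField f q⟩)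
    (hchar : ∀ u : (ZMod N)ˣ, DirichletCharacter.changeLevel hM₀ (nebentypus g₀) (u : ZMod N) =
      τ ⟨(nebentypus f (u : ZMod N) : ℂ), nebentypus_apply_mem_coeffCharField f _⟩) :
    M₀ = N := by
  classical
  -- `K_{g₀}` is a number field
  haveI : FiniteDimensional ℚ (coeffField g₀) :=
    (IsNewform1.finiteDimensional_coeffField_of_span_integralLattice1
      (DeligneSerre1974_span_integralLattice1_holds M₀ w)) hg₀
  haveI : FiniteDimensional ℚ (coeffCharField g₀) :=
    DeligneSerre1974.finiteDimensional_coeffCharField g₀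
  haveI : Algebra.IsAlgebraic ℚ (coeffCharField g₀) := Algebra.IsAlgebraic.of_finite ℚ _
  -- the subfield `R = {x ∈ K_f | τ x ∈ K_{g₀}}`, `φ = τ|_R : R → K_{g₀}`, and `ψ ∘ φ = id`
  let R : Subfield (coeffCharField f) := Subfield.comap τ (coeffCharField g₀).toSubfield
  let φ : R →+* coeffCharField g₀ := (τ.comp R.subtype).codRestrict (coeffCharField g₀) fun x => x.2
  have hφ : ∀ x : R, ((φ x : coeffCharField g₀) : ℂ) = τ (x : coeffCharField f) := fun _ => rfl
  letI algRK : Algebra R (coeffCharField g₀) := φ.toAlgebra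
  letI : Module R (coeffCharField g₀) := algRK.toModule
  letI algRC : Algebra R ℂ := ((algebraMap (coeffCharField f) ℂ).comp R.subtype).toAlgebra
  letI : Module R ℂ := algRC.toModule
  haveI : IsScalarTower ℚ R (coeffCharField g₀) := IsScalarTower.of_algebraMap_eq fun r =>
    RingHom.congr_fun (Subsingleton.elim (algebraMap ℚ (coeffCharField g₀))
      ((algebraMap R (coeffCharField g₀)).comp (algebraMap ℚ R))) r
  haveI : Algebra.IsAlgebraic R (coeffCharField g₀) := Algebra.IsAlgebraic.tower_top (K := ℚ) R
  haveI : Module.IsTorsionFree R (coeffCharField g₀) := DivisionSemiring.to_moduleIsTorsionFree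
  haveI : Module.IsTorsionFree R ℂ := DivisionSemiring.to_moduleIsTorsionFree
  let ψ : coeffCharField g₀ →ₐ[R] ℂ := IsAlgClosed.lift
  have hψ : ∀ x : R, ψ (φ x) = ((x : coeffCharField f) : ℂ) := fun x => ψ.commutes x
  -- conjugate `g₀` back along `ψ` and take the newform of the packet
  obtain ⟨g₂, hg₂0, hg₂T, hg₂d⟩ := exists_conjEigenvector hg₀ ψ.toRingHom
  obtain ⟨ε₂, hε₂⟩ := exists_dirichletCharacter_conj g₀ ψ.toRingHom
  have hg₂χ : g₂ ∈ nebentypusSubspace M₀ w ε₂ := by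
    rw [mem_nebentypusSubspace_iff_diamondOp]
    intro d
    rw [hg₂d d, hε₂ _ d.isUnit]
  obtain ⟨M₃, hM₃0, hM₃, g₃, hg₃, hcoeff₃, hchar₃⟩ :=
    exists_isNewform1_of_eigenpacket hg₂0 hg₂χ
      (a := fun q ↦ ψ.toRingHom ⟨cuspCoeff g₀ q, cuspCoeff_mem_coeffCharField g₀ q⟩)
      (fun q hq _ ↦ hg₂T q hq)
  -- the packet of `g₃` is the packet of `f`: coefficients
  have hmemRa : ∀ (q : ℕ), q.Prime → ¬ q ∣ N →
      (⟨cuspCoeff f q, cuspCoeff_mem_coeffCharField f q⟩ : coeffCharField f) ∈ R :=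
    fun q hq hqN => by
    show τ _ ∈ (coeffCharField g₀).toSubfield
    rw [IntermediateField.mem_toSubfield, ← hcoeff q hq hqN]
    exact cuspCoeff_mem_coeffCharField g₀ q
  have hcoeff₃' : ∀ q : ℕ, q.Prime → ¬ q ∣ N → cuspCoeff g₃ q = cuspCoeff f q := by
    intro q hq hqN
    have hqM₀ : ¬ q ∣ M₀ := fun h => hqN (h.trans hM₀)
    rw [hcoeff₃ q hq hqM₀]
    have e : (⟨cuspCoeff g₀ q, cuspCoeff_mem_coeffCharField g₀ q⟩ : coeffCharField g₀) =
        φ ⟨_, hmemRa q hq hqN⟩ :=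
      Subtype.ext (by rw [hφ]; exact hcoeff q hq hqN)
    change ψ _ = _
    rw [e, hψ]
  -- … and character
  have hu : ∀ u : (ZMod N)ˣ,
      ((ZMod.unitsMap hM₀ u : (ZMod M₀)ˣ) : ZMod M₀) = ZMod.cast (u : ZMod N) := fun u => by
    rw [ZMod.unitsMap_def, Units.coe_map]
    rfl
  have hmemRe : ∀ u : (ZMod N)ˣ,
      (⟨(nebentypus f (u : ZMod N) : ℂ), nebentypus_apply_mem_coeffCharField f _⟩ :
        coeffCharField f) ∈ R :=
    fun u => by
    show τ _ ∈ (coeffCharField g₀).toSubfield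
    rw [IntermediateField.mem_toSubfield, ← hchar u,
      DirichletCharacter.changeLevel_eq_cast_of_dvd _ hM₀]
    exact nebentypus_apply_mem_coeffCharField g₀ _
  have hchar₃' : DirichletCharacter.changeLevel (hM₃.trans hM₀) (nebentypus g₃) = nebentypus f := by
    refine MulChar.ext fun u => ?_
    rw [DirichletCharacter.changeLevel_trans _ hM₃ hM₀,
      DirichletCharacter.changeLevel_eq_cast_of_dvd _ hM₀, ← hu u, hchar₃,
      hε₂ _ (ZMod.unitsMap hM₀ u).isUnit]
    have e : (⟨(nebentypus g₀ ((ZMod.unitsMap hM₀ u : (ZMod M₀)ˣ) : ZMod M₀) : ℂ),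
        nebentypus_apply_mem_coeffCharField g₀ _⟩ : coeffCharField g₀) = φ ⟨_, hmemRe u⟩ :=
      Subtype.ext (by
        rw [hφ, ← hchar u, DirichletCharacter.changeLevel_eq_cast_of_dvd _ hM₀, hu])
    change ψ _ = _
    rw [e, hψ]
  -- multiplicity one across levels
  have hM₃N : M₃ = N :=
    level_eq_of_isNewform1_of_cuspCoeff_eq hf (hM₃.trans hM₀) hg₃ hcoeff₃' hchar₃'
  rw [hM₃N] at hM₃
  exact Nat.dvd_antisymm hM₀ hM₃

/-- **Galois-conjugate newforms are newforms of the same level** (Diamond–Shurman Thm. 6.5.4;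
Shimura 1971, Thm. 3.48; Deligne–Serre 1974, (2.7.4)).  For a newform `f ∈ S_w(Γ₁(N))` and a ring
embedding `τ : K_f → ℂ` of its coefficient field there is a newform `g ∈ S_w(Γ₁(N))` OF THE SAME
LEVEL whose Hecke polynomials `X² - a_q(g) X + ε_g(q) q^{w-1}` at the primes `q ∤ N` are the
`τ`-conjugates of those of `f`.  Proof: the conjugate eigenvector at level `N`
(`exists_conjEigenvector`), the newform of its packet at a level `M₀ ∣ N`
(`exists_isNewform1_of_eigenpacket`), `M₀ = N` by `level_eq_of_conj_packet`, and the coefficientwise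
comparison of the Hecke polynomials (as in the landed `stub_conjugateNewform`).
[cite: DiamondShurman2005, Thm. 6.5.4] [cite: DeligneSerreASENS1974, Prop. 2.7 (2.7.4)] -/
theorem conjugateNewform_sameLevel :
    ∀ (N : ℕ) [NeZero N] (w : ℤ) (f : CuspForm (Gamma1 N) w), IsNewform1 f →
      ∀ τ : coeffCharField f →+* ℂ,
        ∃ g : CuspForm (Gamma1 N) w, IsNewform1 g ∧
          ∀ q : ℕ, q.Prime → ¬ q ∣ N →
            (heckePolynomial g q).map (algebraMap (coeffCharField g) ℂ) =
              (heckePolynomial f q).map τ := by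
  intro N _ w f hf τ
  classical
  obtain ⟨g₁, hg0, hgT, hgd⟩ := exists_conjEigenvector hf τ
  obtain ⟨ε', hε'⟩ := exists_dirichletCharacter_conj f τ
  have hgχ : g₁ ∈ nebentypusSubspace N w ε' := by
    rw [mem_nebentypusSubspace_iff_diamondOp]
    intro d
    rw [hgd d, hε' _ d.isUnit]
  obtain ⟨M₀, hM₀0, hM₀, g₀, hg₀, hcoeff, hchar⟩ :=
    exists_isNewform1_of_eigenpacket hg0 hgχ
      (a := fun p ↦ τ ⟨cuspCoeff f p, cuspCoeff_mem_coeffCharField f p⟩)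
      (fun p hp _ ↦ hgT p hp)
  have hchar' : ∀ u : (ZMod N)ˣ,
      DirichletCharacter.changeLevel hM₀ (nebentypus g₀) (u : ZMod N) =
        τ ⟨(nebentypus f (u : ZMod N) : ℂ), nebentypus_apply_mem_coeffCharField f _⟩ := fun u => by
    rw [hchar]
    exact hε' _ u.isUnit
  have hMN : N = M₀ := (level_eq_of_conj_packet hf τ hM₀ hg₀ hcoeff hchar').symm
  subst hMN
  refine ⟨g₀, hg₀, fun q hq hqN ↦ ?_⟩
  -- the coefficient `a_q(g₀) = τ(a_q(f))`
  have ha : (UpperHalfPlane.qExpansion 1 ⇑g₀).coeff q =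
      τ ⟨cuspCoeff f q, cuspCoeff_mem_coeffCharField f q⟩ :=
    hcoeff q hq hqN
  -- the character value `ε_{g₀}(q) = τ(ε_f(q))`
  have hε : (nebentypus g₀ (q : ZMod N) : ℂ) =
      τ ⟨(nebentypus f (q : ZMod N) : ℂ), nebentypus_apply_mem_coeffCharField f _⟩ := by
    obtain ⟨u, hu⟩ := ZMod.isUnit_prime_of_not_dvd hq hqN
    rw [DirichletCharacter.changeLevel_self] at hchar
    rw [hchar, ← hu]
    exact hε' _ u.isUnit
  -- `τ` fixes `q^{w-1}`
  have hz : (((q : coeffCharField f) ^ (w - 1) : coeffCharField f) : ℂ) = (q : ℂ) ^ (w - 1) := by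
    have h := map_zpow₀ (algebraMap (coeffCharField f) ℂ) (q : coeffCharField f) (w - 1)
    rwa [map_natCast] at h
  have hsub : (⟨(nebentypus f (q : ZMod N) : ℂ) * (q : ℂ) ^ (w - 1),
        nebentypus_mul_zpow_mem_coeffCharField f q⟩ : coeffCharField f) =
      ⟨(nebentypus f (q : ZMod N) : ℂ), nebentypus_apply_mem_coeffCharField f _⟩ *
        (q : coeffCharField f) ^ (w - 1) :=
    Subtype.ext (by rw [MulMemClass.coe_mul, hz])
  have hconst : (nebentypus g₀ (q : ZMod N) : ℂ) * (q : ℂ) ^ (w - 1) =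
      τ ⟨(nebentypus f (q : ZMod N) : ℂ) * (q : ℂ) ^ (w - 1),
        nebentypus_mul_zpow_mem_coeffCharField f q⟩ := by
    rw [hsub, map_mul, map_zpow₀, map_natCast τ, hε]
  rw [map_heckePolynomial, heckePolynomial]
  simp only [Polynomial.map_add, Polynomial.map_sub, Polynomial.map_mul, Polynomial.map_pow,
    Polynomial.map_X, Polynomial.map_C]
  rw [ha, hconst]
  rfl

end Summit.Langlands.Langlands.Cruxes.AdjointLiftingGL3.Birth

end
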